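import Summits.FinalStateConjecture.FinalStateConjecture.Theorems.EIHFluxBalanceInertialRecessionStubEndgameOracleTightIncrement

/-!
# Route EIHFluxBalance — crux `InertialRecession`, line `sublinear-is-free-clean-window-charges`:
# the increment oracle for tight member sets with MIXED outsiders (ballistic or far at scale `t`)

Helper file for the crux `stmt-FinalStateConjecture-10166`
(`Summit.FinalStateConjecture.FinalStateConjecture.Theses.EIHFluxBalance.InertialRecession`), registered stub `stub_incrementOracle`
(lead reshape r9/r10) of `Cruxes/InertialRecession/Lines/sublinear_is_free_clean_window_charges.lean`; continues `…OracleTightIncrement`.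

In the piece decomposition of a slow member set (lead's roadmap §4/§8) the non-members of a PIECE are of two kinds: genuine outsiders of
the slow set (BALLISTIC relative to the reference, floor `W/2`) and the other pieces (not ballistic, but FAR: distance `≥ λs` at time `s`).
`integral_radius_le_mixed` bounds the window-law integrand of the explicit radius `R = min(c₀s, (2/3)·min_{j∉P}‖ξⱼ − ξₐ‖)` accordingly:
`∫R^{-3/2} ≤ 2c₀^{-3/2}t₁^{-1/2} + |B|·2·2√2·8/(W√A₀) + |F|·2·2λ^{-3/2}t₁^{-1/2}`, and `tight_increment_mixed` is the corresponding
increment oracle for a tight piece (via the landed `increment_of_windowPath`).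
-/

noncomputable section

set_option linter.dupNamespace false

open Filter Topology Set MeasureTheory intervalIntegral
open scoped Topology BigOperators InnerProductSpace RealInnerProductSpace

namespace Summit.FinalStateConjecture.FinalStateConjecture.Theorems.SublinearIsFree.Oracle

open Literature.Geometry.Lorentzian
open Summit.FinalStateConjecture.FinalStateConjecture.Theorems.SublinearIsFree.Endgame
open Summit.FinalStateConjecture.FinalStateConjecture.Theorems.SublinearIsFree.Toy

set_option maxHeartbeats 800000 in
/-- **THE INTEGRAL OF THE EXPLICIT RADIUS, MIXED OUTSIDERS.** As `integral_radius_le`, with the complement `Sc = B ∪ F` split into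
ballistic outsiders `B` (unit direction `n j`, `⟪ξ̇ⱼ − ξ̇ₐ, n j⟫ ≥ W/2`, distance `≥ A₀`) and far outsiders `F` (distance `≥ λs` at
time `s`). [folklore] -/
theorem integral_radius_le_mixed {N : ℕ} (ξ : Fin N → ℝ → E3) (hξ : ∀ i, ContDiff ℝ 1 (ξ i)) (Sc B F : Finset (Fin N))
    (hSc : Sc.Nonempty) (hBF : ∀ j ∈ Sc, j ∈ B ∨ j ∈ F)
    (a : Fin N) {t₁ t₂ c₀ W A₀ lam : ℝ} (ht₁ : 0 < t₁) (h12 : t₁ ≤ t₂) (hc₀ : 0 < c₀) (hW : 0 < W) (hA₀ : 0 < A₀) (hlam : 0 < lam)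
    (n : Fin N → E3) (hn : ∀ j ∈ B, ‖n j‖ = 1)
    (hspeed : ∀ j ∈ B, ∀ s ∈ Icc t₁ t₂, W / 2 ≤ ⟪deriv (ξ j) s - deriv (ξ a) s, n j⟫)
    (hfarB : ∀ j ∈ B, ∀ s ∈ Icc t₁ t₂, A₀ ≤ ‖ξ j s - ξ a s‖)
    (hfarF : ∀ j ∈ F, ∀ s ∈ Icc t₁ t₂, lam * s ≤ ‖ξ j s - ξ a s‖) :
    ∫ s in t₁..t₂, ((min (c₀ * s) (2 / 3 * Sc.inf' hSc fun j ↦ ‖ξ j s - ξ a s‖)) ^ (3 / 2 : ℝ))⁻¹ ≤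
      2 * (c₀ ^ (3 / 2 : ℝ))⁻¹ * (t₁ ^ (1 / 2 : ℝ))⁻¹ + B.card * (2 * (2 * √2 * (8 / (W * √A₀)))) +
        F.card * (2 * (2 * (lam ^ (3 / 2 : ℝ))⁻¹ * (t₁ ^ (1 / 2 : ℝ))⁻¹)) := by
  classical
  -- majorants: ballistic `ψ j`, far `φ`
  set ψ : Fin N → ℝ → ℝ := fun j s ↦ 2 * √2 * ((|⟪ξ j s - ξ a s, n j⟫| + A₀) * √(|⟪ξ j s - ξ a s, n j⟫| + A₀))⁻¹ with hψ
  set φ : ℝ → ℝ := fun s ↦ ((lam * s) ^ (3 / 2 : ℝ))⁻¹ with hφ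
  have hball : ∀ j ∈ B, (∀ s ∈ Icc t₁ t₂, (‖ξ j s - ξ a s‖ * √‖ξ j s - ξ a s‖)⁻¹ ≤ ψ j s) ∧
      ContinuousOn (ψ j) (Icc t₁ t₂) ∧ ∫ s in t₁..t₂, ψ j s ≤ 2 * √2 * (8 / (W * √A₀)) := fun j hj ↦
    ballistic_majorant_inner (hξ a) (hξ j) (hn j hj) h12 hW hA₀ (hspeed j hj) (hfarB j hj)
  have hψ0 : ∀ j s, 0 ≤ ψ j s := fun j s ↦ by positivity
  have hφ0 : ∀ s ∈ Icc t₁ t₂, 0 ≤ φ s := fun s hs ↦ by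
    have : 0 < lam * s := mul_pos hlam (ht₁.trans_le hs.1)
    positivity
  have hfar' : ∀ j ∈ F, ∀ s ∈ Icc t₁ t₂, (‖ξ j s - ξ a s‖ * √‖ξ j s - ξ a s‖)⁻¹ ≤ φ s := by
    intro j hj s hs
    have hls : 0 < lam * s := mul_pos hlam (ht₁.trans_le hs.1)
    have hd : lam * s ≤ ‖ξ j s - ξ a s‖ := hfarF j hj s hs
    rw [hφ]; dsimp only
    rw [rpow_three_halves_eq hls.le]
    have hd0 : 0 < ‖ξ j s - ξ a s‖ := hls.trans_le hd
    refine inv_anti₀ (by positivity) ?_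
    exact mul_le_mul hd (Real.sqrt_le_sqrt hd) (Real.sqrt_nonneg _) hd0.le
  -- positivity of the minimum distance
  have hDpos : ∀ s ∈ Icc t₁ t₂, 0 < Sc.inf' hSc fun j ↦ ‖ξ j s - ξ a s‖ := by
    intro s hs
    obtain ⟨j, hj, hjmin⟩ := Finset.exists_mem_eq_inf' hSc (fun j ↦ ‖ξ j s - ξ a s‖)
    rw [hjmin]
    rcases hBF j hj with h | h
    · exact hA₀.trans_le (hfarB j h s hs)
    · exact (mul_pos hlam (ht₁.trans_le hs.1)).trans_le (hfarF j h s hs)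
  -- pointwise bound
  have hpt : ∀ s ∈ Icc t₁ t₂, ((min (c₀ * s) (2 / 3 * Sc.inf' hSc fun j ↦ ‖ξ j s - ξ a s‖)) ^ (3 / 2 : ℝ))⁻¹ ≤
      ((c₀ * s) ^ (3 / 2 : ℝ))⁻¹ + (2 * ∑ j ∈ B, ψ j s + 2 * (F.card * φ s)) := by
    intro s hs
    have hcs : 0 < c₀ * s := mul_pos hc₀ (ht₁.trans_le hs.1)
    have hD := hDpos s hs
    have h23 : 0 < 2 / 3 * Sc.inf' hSc (fun j ↦ ‖ξ j s - ξ a s‖) := by positivity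
    have h1 := inv_rpow_min_le hcs h23
    obtain ⟨j₀, hj₀, hjmin⟩ := Finset.exists_mem_eq_inf' hSc (fun j ↦ ‖ξ j s - ξ a s‖)
    have hd0 : 0 < ‖ξ j₀ s - ξ a s‖ := by rw [← hjmin]; exact hD
    have h2 : ((2 / 3 * Sc.inf' hSc (fun j ↦ ‖ξ j s - ξ a s‖)) ^ (3 / 2 : ℝ))⁻¹ ≤
        2 * ∑ j ∈ B, ψ j s + 2 * (F.card * φ s) := by
      rw [inv_rpow_three_halves h23.le, hjmin]
      have hstep : (2 / 3 * ‖ξ j₀ s - ξ a s‖ * √(2 / 3 * ‖ξ j₀ s - ξ a s‖))⁻¹ ≤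
          2 * (‖ξ j₀ s - ξ a s‖ * √‖ξ j₀ s - ξ a s‖)⁻¹ := inv_two_thirds_mul_sqrt_le hd0
      have hsumB : 0 ≤ ∑ j ∈ B, ψ j s := Finset.sum_nonneg fun j _ ↦ hψ0 j s
      have hFφ : 0 ≤ (F.card : ℝ) * φ s := mul_nonneg (Nat.cast_nonneg _) (hφ0 s hs)
      rcases hBF j₀ hj₀ with h | h
      · have := (hball j₀ h).1 s hs
        have hle : ψ j₀ s ≤ ∑ j ∈ B, ψ j s := Finset.single_le_sum (fun j _ ↦ hψ0 j s) h
        linarith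
      · have := hfar' j₀ h s hs
        have hle : φ s ≤ F.card * φ s := by
          have h1c : (1 : ℝ) ≤ F.card := by exact_mod_cast Finset.card_pos.mpr ⟨j₀, h⟩
          nlinarith [hφ0 s hs]
        linarith
    linarith
  -- continuity / integrability
  have hLcont : ContinuousOn (fun s ↦ ((min (c₀ * s) (2 / 3 * Sc.inf' hSc fun j ↦ ‖ξ j s - ξ a s‖)) ^ (3 / 2 : ℝ))⁻¹)
      (Icc t₁ t₂) := by
    have hdist : ∀ j, Continuous fun s ↦ ‖ξ j s - ξ a s‖ := fun j ↦
      ((hξ j).continuous.sub (hξ a).continuous).norm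
    have hinf : Continuous fun s ↦ Sc.inf' hSc fun j ↦ ‖ξ j s - ξ a s‖ := by
      have h := Continuous.finset_inf' hSc (f := fun j s ↦ ‖ξ j s - ξ a s‖) fun j _ ↦ hdist j
      convert h using 1
      ext s
      simp [Finset.inf'_apply]
    have hm : Continuous fun s ↦ min (c₀ * s) (2 / 3 * Sc.inf' hSc fun j ↦ ‖ξ j s - ξ a s‖) :=
      (continuous_const.mul continuous_id).min (continuous_const.mul hinf)
    have hmpos : ∀ s ∈ Icc t₁ t₂, 0 < min (c₀ * s) (2 / 3 * Sc.inf' hSc fun j ↦ ‖ξ j s - ξ a s‖) := fun s hs ↦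
      lt_min (mul_pos hc₀ (ht₁.trans_le hs.1)) (by have := hDpos s hs; positivity)
    refine (hm.continuousOn.rpow_const fun s hs ↦ Or.inl (hmpos s hs).ne').inv₀ fun s hs ↦ ?_
    exact (Real.rpow_pos_of_pos (hmpos s hs) _).ne'
  have hmul_cont : ∀ c : ℝ, 0 < c → ContinuousOn (fun s ↦ ((c * s) ^ (3 / 2 : ℝ))⁻¹) (Icc t₁ t₂) := by
    intro c hc
    refine ContinuousOn.inv₀ ?_ fun s hs ↦ (Real.rpow_pos_of_pos (mul_pos hc (ht₁.trans_le hs.1)) _).ne'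
    exact (continuousOn_const.mul continuousOn_id).rpow_const fun s hs ↦ Or.inl (mul_pos hc (ht₁.trans_le hs.1)).ne'
  have hR1cont := hmul_cont c₀ hc₀
  have hφcont : ContinuousOn φ (Icc t₁ t₂) := hmul_cont lam hlam
  have hR2cont : ContinuousOn (fun s ↦ 2 * ∑ j ∈ B, ψ j s + 2 * (F.card * φ s)) (Icc t₁ t₂) :=
    (continuousOn_const.mul (continuousOn_finsetSum _ fun j hj ↦ (hball j hj).2.1)).add
      (continuousOn_const.mul (continuousOn_const.mul hφcont))
  have hI1 := integral_inv_rpow_three_halves_mul_le hc₀ ht₁ h12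
  have hIφ : ∫ s in t₁..t₂, φ s ≤ 2 * (lam ^ (3 / 2 : ℝ))⁻¹ * (t₁ ^ (1 / 2 : ℝ))⁻¹ :=
    integral_inv_rpow_three_halves_mul_le hlam ht₁ h12
  have hI2 : ∫ s in t₁..t₂, (2 * ∑ j ∈ B, ψ j s + 2 * (F.card * φ s)) ≤
      B.card * (2 * (2 * √2 * (8 / (W * √A₀)))) + F.card * (2 * (2 * (lam ^ (3 / 2 : ℝ))⁻¹ * (t₁ ^ (1 / 2 : ℝ))⁻¹)) := by
    have hiB : IntervalIntegrable (fun s ↦ 2 * ∑ j ∈ B, ψ j s) volume t₁ t₂ :=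
      (continuousOn_const.mul (continuousOn_finsetSum _ fun j hj ↦ (hball j hj).2.1)).intervalIntegrable_of_Icc h12
    have hiF : IntervalIntegrable (fun s ↦ 2 * (F.card * φ s)) volume t₁ t₂ :=
      (continuousOn_const.mul (continuousOn_const.mul hφcont)).intervalIntegrable_of_Icc h12
    rw [intervalIntegral.integral_add hiB hiF, intervalIntegral.integral_const_mul,
      intervalIntegral.integral_finsetSum fun j hj ↦ ((hball j hj).2.1.intervalIntegrable_of_Icc h12),
      intervalIntegral.integral_const_mul, intervalIntegral.integral_const_mul]
    have hB' : ∑ j ∈ B, ∫ s in t₁..t₂, ψ j s ≤ ∑ j ∈ B, 2 * √2 * (8 / (W * √A₀)) :=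
      Finset.sum_le_sum fun j hj ↦ (hball j hj).2.2
    rw [Finset.sum_const, nsmul_eq_mul] at hB'
    have hF0 : (0 : ℝ) ≤ F.card := Nat.cast_nonneg _
    nlinarith [hB', hIφ, hF0]
  calc ∫ s in t₁..t₂, ((min (c₀ * s) (2 / 3 * Sc.inf' hSc fun j ↦ ‖ξ j s - ξ a s‖)) ^ (3 / 2 : ℝ))⁻¹
      ≤ ∫ s in t₁..t₂, (((c₀ * s) ^ (3 / 2 : ℝ))⁻¹ + (2 * ∑ j ∈ B, ψ j s + 2 * (F.card * φ s))) :=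
        intervalIntegral.integral_mono_on h12 (hLcont.intervalIntegrable_of_Icc h12)
          ((hR1cont.add hR2cont).intervalIntegrable_of_Icc h12) hpt
    _ = (∫ s in t₁..t₂, ((c₀ * s) ^ (3 / 2 : ℝ))⁻¹) + ∫ s in t₁..t₂, (2 * ∑ j ∈ B, ψ j s + 2 * (F.card * φ s)) :=
        intervalIntegral.integral_add (hR1cont.intervalIntegrable_of_Icc h12) (hR2cont.intervalIntegrable_of_Icc h12)
    _ ≤ _ := by linarith

/-- Registered helper form: the far-outsider majorant `((λs)^{3/2})⁻¹` integrates to at most `2λ^{-3/2}t₁^{-1/2}` (carrier of this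
file). [folklore] -/
theorem oracle_integral_far_majorant_le : ∀ (lam t₁ t₂ : ℝ), 0 < lam → 0 < t₁ → t₁ ≤ t₂ →
    ∫ s in t₁..t₂, ((lam * s) ^ (3 / 2 : ℝ))⁻¹ ≤ 2 * (lam ^ (3 / 2 : ℝ))⁻¹ * (t₁ ^ (1 / 2 : ℝ))⁻¹ :=
  fun _ _ _ hlam ht₁ h12 ↦ integral_inv_rpow_three_halves_mul_le hlam ht₁ h12

end Summit.FinalStateConjecture.FinalStateConjecture.Theorems.SublinearIsFree.Oracle

end
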